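import Literature.AlgebraicGeometry.Motives.CartierDivisorCocycleIntegral
import Mathlib.AlgebraicGeometry.Morphisms.UniversallyClosed
import HarnessLib

/-!
# Line bundles on a scheme proper over a local base that are trivial near the closed fibre

Three elementary pieces of the DVR-lifting step for line bundles (Görtz–Wedhorn II, proof of
Thm. 27.168 / Lemma 24.72, Step (III): a global section whose restriction to the closed fibre is a
trivialisation trivialises the bundle, as its zero locus is closed, proper over the base and misses
the closed fibre), in the concrete model of `Motives/CartierDivisor`:

* `CartierDivisor.SectionAlong.exists_eq_mul` — **chart-form global sections of `𝒪_X(D)` along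
  `𝟙 X` are rational sections**: for `s : D.SectionAlong (𝟙 X)` there is `φ ∈ K(X)` with
  `D.IsSection φ` and `σ_i = f_i φ` (Görtz–Wedhorn I, (11.9): `Γ(X, 𝒪_X(D)) ⊆ K(X)`);
* `RatFn.isUnitAt_of_isUnit_appLE` — if `ψ^*σ` is a unit on `V ⊆ ψ⁻¹U` then `σ` is a unit at the
  points of `ψ(V)`;
* `CartierDivisor.linEquiv_zero_of_isUnitAt_closedFibre` — **for `pr : X → Spec R` universally
  closed, `R` local, a rational section `φ ≠ 0` of `𝒪_X(D)` which generates at every point of the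
  closed fibre generates everywhere, so `D ∼ 0`**: the locus where `f_i φ` is not a unit is closed,
  its image in `Spec R` is closed and misses the closed point, hence is empty.

Everything is proved; no named facts.

## References

* U. Görtz, T. Wedhorn, *Algebraic Geometry I* (2020), Section (11.9) (p. 374); *Algebraic
  Geometry II* (2023), Lemma 24.72 and Thm. 27.168. [GortzWedhorn2020] [GortzWedhorn2023]
-/

universe u

open CategoryTheory AlgebraicGeometry TopologicalSpace Opposite

noncomputable section

namespace Literature.AlgebraicGeometry.Motives

namespace RatFn

variable {X X'' : Scheme.{u}} [IsIntegral X]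

/-- **Units pulled back from a unit**: if `ψ^*σ ∈ Γ(V, 𝒪_{X''})` is a unit (`V ⊆ ψ⁻¹U`), then the
rational function of `σ ∈ Γ(U, 𝒪_X)` is a unit at `ψ(x)` for every `x ∈ V`
(`X''_{ψ^*σ} = V ∩ ψ⁻¹X_σ`). [folklore] -/
theorem isUnitAt_of_isUnit_appLE (ψ : X'' ⟶ X) {U : X.Opens} {V : X''.Opens} (e : V ≤ ψ ⁻¹ᵁ U)
    {σ : Γ(X, U)} (hu : IsUnit (ψ.appLE U V e σ)) {x : X''} (hx : x ∈ V) :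
    IsUnitAt (ψ x) (ofSection (genericPoint_mem_of_mem (show ψ x ∈ U from e hx)) σ) := by
  have hψx : ψ x ∈ U := e hx
  rw [isUnitAt_ofSection_iff hψx]
  have h : x ∈ X''.basicOpen (ψ.appLE U V e σ) := by
    rw [X''.basicOpen_of_isUnit hu]; exact hx
  rw [Scheme.basicOpen_appLE] at h
  exact h.2

end RatFn

namespace CartierDivisor

open RatFn

variable {X : Scheme.{u}} [IsIntegral X] (D : CartierDivisor X)

/-- **A chart-form global section of `𝒪_X(D)` (along `𝟙 X`) is a rational section**: there is
`φ ∈ K(X)` with `f_i φ` regular on `U_i` (`D.IsSection φ`) and `σ_i = f_i φ` in `K(X)`.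
[cite: GortzWedhorn2020, Section (11.9) (p. 374)] -/
theorem SectionAlong.exists_eq_mul (s : D.SectionAlong (𝟙 X)) :
    ∃ φ : X.functionField, D.IsSection φ ∧
      ∀ (i : D.ι) (hi : genericPoint X ∈ D.U i), ofSection hi (s.σ i) = D.f i * φ := by
  obtain ⟨i₀, hi₀⟩ := D.covers (genericPoint X)
  refine ⟨ofSection hi₀ (s.σ i₀) / D.f i₀, ?_, ?_⟩
  · -- the key identity first
    have key : ∀ (i : D.ι) (hi : genericPoint X ∈ D.U i),
        ofSection hi (s.σ i) = D.f i * (ofSection hi₀ (s.σ i₀) / D.f i₀) := fun i hi => by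
      have hV : genericPoint X ∈ (𝟙 X : X ⟶ X) ⁻¹ᵁ D.U i ⊓ (𝟙 X : X ⟶ X) ⁻¹ᵁ D.U i₀ := ⟨hi, hi₀⟩
      have hc := congrArg (ofSection hV) (s.cocycle i i₀)
      simp only [map_mul, ofSection_map, ofSection_appLE, ofSection_transFun,
        pullbackFn_eq_functionFieldMap, functionFieldMap_id, RingHom.id_apply] at hc
      rw [show ofSection ((homOfLE (inf_le_left : (𝟙 X : X ⟶ X) ⁻¹ᵁ D.U i ⊓
          (𝟙 X : X ⟶ X) ⁻¹ᵁ D.U i₀ ≤ _)).le hV) (s.σ i) = ofSection hi (s.σ i) from rfl,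
        show ofSection ((homOfLE (inf_le_right : (𝟙 X : X ⟶ X) ⁻¹ᵁ D.U i ⊓
          (𝟙 X : X ⟶ X) ⁻¹ᵁ D.U i₀ ≤ _)).le hV) (s.σ i₀) = ofSection hi₀ (s.σ i₀) from rfl] at hc
      rw [hc]
      field_simp [D.f_ne_zero i₀]
    intro i x hx
    have hi : genericPoint X ∈ D.U i := genericPoint_mem_of_mem hx
    rw [← key i hi]
    exact isRegularAt_ofSection hx _
  · intro i hi
    have hV : genericPoint X ∈ (𝟙 X : X ⟶ X) ⁻¹ᵁ D.U i ⊓ (𝟙 X : X ⟶ X) ⁻¹ᵁ D.U i₀ := ⟨hi, hi₀⟩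
    have hc := congrArg (ofSection hV) (s.cocycle i i₀)
    simp only [map_mul, ofSection_map, ofSection_appLE, ofSection_transFun,
      pullbackFn_eq_functionFieldMap, functionFieldMap_id, RingHom.id_apply] at hc
    rw [show ofSection ((homOfLE (inf_le_left : (𝟙 X : X ⟶ X) ⁻¹ᵁ D.U i ⊓
        (𝟙 X : X ⟶ X) ⁻¹ᵁ D.U i₀ ≤ _)).le hV) (s.σ i) = ofSection hi (s.σ i) from rfl,
      show ofSection ((homOfLE (inf_le_right : (𝟙 X : X ⟶ X) ⁻¹ᵁ D.U i ⊓
        (𝟙 X : X ⟶ X) ⁻¹ᵁ D.U i₀ ≤ _)).le hV) (s.σ i₀) = ofSection hi₀ (s.σ i₀) from rfl] at hc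
    rw [hc]
    field_simp [D.f_ne_zero i₀]

/-- **The non-generating locus of a rational section is closed**: for `φ` with `f_i φ` regular on
`U_i`, the set of points `y` (in some, equivalently any, chart `U_i ∋ y`) where `f_i φ` is not a
unit is closed — on `U_i` it is the complement of the basic open of the section `f_i φ`.
[folklore] -/
theorem isClosed_nonGenerating {φ : X.functionField} (hsec : D.IsSection φ) :
    IsClosed {y : X | ∃ i, y ∈ D.U i ∧ ¬ IsUnitAt y (D.f i * φ)} := by
  rw [← isOpen_compl_iff, isOpen_iff_forall_mem_open]
  intro y hy
  simp only [Set.mem_compl_iff, Set.mem_setOf_eq, not_exists, not_and, not_not] at hy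
  obtain ⟨i, hi⟩ := D.covers y
  have hη : genericPoint X ∈ D.U i := genericPoint_mem_of_mem hi
  let t : Γ(X, D.U i) := sectionOf hη (D.f i * φ) fun x hx => hsec i x hx
  refine ⟨X.basicOpen t, fun y' hy' => ?_, (X.basicOpen t).isOpen, ?_⟩
  · simp only [Set.mem_compl_iff, Set.mem_setOf_eq, not_exists, not_and, not_not]
    intro j hj
    have hyi : y' ∈ D.U i := X.basicOpen_le t hy'
    have hu : IsUnitAt y' (D.f i * φ) := by
      have := (isUnitAt_ofSection_iff hyi t).2 hy'
      rwa [ofSection_sectionOf] at this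
    have e : D.f j * φ = D.f j / D.f i * (D.f i * φ) := by field_simp [D.f_ne_zero i]
    rw [e]
    exact (D.isUnitAt_div j i y' hj hyi).mul hu
  · change y ∈ X.basicOpen t
    rw [← isUnitAt_ofSection_iff hi t, ofSection_sectionOf]
    exact hy i hi

/-- **A rational section generating along the closed fibre generates everywhere** (`pr : X → Spec R`
universally closed, `R` local): if `φ ≠ 0`, `f_i φ` is regular on `U_i`, and `f_i φ ∈ 𝒪_{X,y}^×`
for the points `y` over the closed point, then `D ∼ 0` (through `φ`). The non-generating locus is
closed, so is its image in `Spec R`, which misses the closed point and is therefore empty.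
[cite: GortzWedhorn2023, Lemma 24.72, Step (III)] -/
theorem linEquiv_zero_of_isUnitAt_closedFibre {R : CommRingCat.{u}} [IsLocalRing R]
    (pr : X ⟶ Spec R) [UniversallyClosed pr] {φ : X.functionField} (hφ : φ ≠ 0)
    (hsec : D.IsSection φ)
    (hunit : ∀ (i : D.ι) (y : X), y ∈ D.U i → pr y = IsLocalRing.closedPoint R →
      IsUnitAt y (D.f i * φ)) :
    D.LinEquiv 0 := by
  -- the non-generating locus is empty
  have hN : {y : X | ∃ i, y ∈ D.U i ∧ ¬ IsUnitAt y (D.f i * φ)} = ∅ := by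
    by_contra hne
    obtain ⟨y, i, hyi, hy⟩ := Set.nonempty_iff_ne_empty.2 hne
    have hcl : IsClosed (pr.base '' {y : X | ∃ i, y ∈ D.U i ∧ ¬ IsUnitAt y (D.f i * φ)}) :=
      pr.isClosedMap _ (D.isClosed_nonGenerating hsec)
    have hmem : IsLocalRing.closedPoint R ∈
        pr.base '' {y : X | ∃ i, y ∈ D.U i ∧ ¬ IsUnitAt y (D.f i * φ)} :=
      (IsLocalRing.specializes_closedPoint (pr y)).mem_closed hcl ⟨y, ⟨i, hyi, hy⟩, rfl⟩
    obtain ⟨y₀, ⟨j, hy₀j, hy₀⟩, hy₀c⟩ := hmem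
    exact hy₀ (hunit j y₀ hy₀j hy₀c)
  rw [linEquiv_iff]
  refine ⟨φ, hφ, fun i j y hi _ => ?_⟩
  rw [zero_f, div_one]
  by_contra h
  have : y ∈ ({y : X | ∃ i, y ∈ D.U i ∧ ¬ IsUnitAt y (D.f i * φ)} : Set X) := ⟨i, hi, h⟩
  rw [hN] at this
  exact this

end CartierDivisor

end Literature.AlgebraicGeometry.Motives

end
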